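import Mathlib.Analysis.Calculus.BumpFunction.Basic
import Mathlib.Analysis.Calculus.BumpFunction.InnerProduct
import Mathlib.Analysis.SpecialFunctions.SmoothTransition
import Mathlib.Analysis.Calculus.Deriv.Support
import Mathlib.Analysis.Calculus.LocalExtr.Basic
import Mathlib.Topology.MetricSpace.ProperSpace.Real
import HarnessLib

/-!
# Cheskidov's periodisation, I: the time cutoffs

Analysis/FluidPDE support file for the proof of the §6 periodisation step of Cheskidov,
arXiv:2311.04182 (2023), Thm. 1.3 (`Literature.Analysis.FluidPDE.cheskidov_time_periodic_anomaly`,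
vendored in `ZerothLaw.lean`) from the total-dissipation family
`Literature.Analysis.FluidPDE.cheskidov_total_dissipation_family` (`CheskidovTotalDissipation.lean`).

Contents (all proved): **the cutoffs of §6, p. 18** with period `τ = 1`:
`CheskidovPeriodic.etaTilde` (`η̃`: smooth, `0` for `t ≤ 1/2 = 1 - τ/2`, `1` for
`t ≥ 2/3 = 1 - τ/3`, values in `[0,1]`), `CheskidovPeriodic.eta` (`η`: smooth bump, `1` on
`[3/4, 5/4] = [1 - τ/4, 1 + τ/4]`, vanishing off `(7/10, 13/10) ⊂ (1 - τ/3, 1 + τ/3)`), the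
vanishing of their derivatives where they are locally extremal (Fermat), a bound for `|η'|`, and
the truncated derivative `CheskidovPeriodic.chi = η' · stepDown` (`= η'` for `t ≤ 4/5`, `= 0` for
`t ≥ 9/10`, supported in `[7/10, 9/10]`), which realises the time profile of the limit scalar force
`h = η' ρ̃ χ_{[1-τ/3, 1-τ/4]}` smoothly and cuts it before the blow-up time `t = 1` of `ρ̃`.
The torus bookkeeping lemmas used alongside live in `TorusForceBookkeeping.lean` (not imported here:
this file is pure real-variable calculus).

## References

* A. Cheskidov, *Dissipation anomaly and anomalous dissipation in incompressible fluid flows*,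
  arXiv:2311.04182 (2023), §6, p. 18.
-/

open Set Filter Topology Function
open scoped ContDiff

noncomputable section

namespace Literature.Analysis.FluidPDE


/-! ## The cutoffs of Cheskidov 2023, §6 (period `τ = 1`) -/

namespace CheskidovPeriodic

/-- **The drift cutoff `η̃`** (Cheskidov 2023, §6, p. 18, with `τ = 1`): a smooth nondecreasing
function, `0` for `t ≤ 1 - τ/2 = 1/2` and `1` for `t ≥ 1 - τ/3 = 2/3`
(`Real.smoothTransition (6 (t - 1/2))`). [cite: Cheskidov2023, §6 p. 18] -/
def etaTilde (t : ℝ) : ℝ := Real.smoothTransition (6 * (t - 2⁻¹))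

/-- `η̃` is smooth. [cite: Cheskidov2023, §6 p. 18] -/
theorem contDiff_etaTilde {n : ℕ∞} : ContDiff ℝ n etaTilde :=
  Real.smoothTransition.contDiff.comp (contDiff_const.mul (contDiff_id.sub contDiff_const))

/-- `η̃ t = 0` for `t ≤ 1/2`. [cite: Cheskidov2023, §6 p. 18] -/
theorem etaTilde_of_le {t : ℝ} (ht : t ≤ 2⁻¹) : etaTilde t = 0 :=
  Real.smoothTransition.zero_of_nonpos (by linarith)

/-- `η̃ t = 1` for `t ≥ 2/3`. [cite: Cheskidov2023, §6 p. 18] -/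
theorem etaTilde_of_ge {t : ℝ} (ht : 2 / 3 ≤ t) : etaTilde t = 1 :=
  Real.smoothTransition.one_of_one_le (by linarith)

/-- `0 ≤ η̃ ≤ 1`. [cite: Cheskidov2023, §6 p. 18] -/
theorem etaTilde_mem_Icc (t : ℝ) : etaTilde t ∈ Icc (0 : ℝ) 1 :=
  ⟨Real.smoothTransition.nonneg _, Real.smoothTransition.le_one _⟩

/-- `η̃' t = 0` for `t ≤ 1/2` and for `t ≥ 2/3`: there `η̃` attains its minimum `0`, resp. its
maximum `1` (Fermat). [folklore] -/
theorem deriv_etaTilde_eq_zero {t : ℝ} (ht : t ≤ 2⁻¹ ∨ 2 / 3 ≤ t) : deriv etaTilde t = 0 := by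
  rcases ht with ht | ht
  · refine IsLocalMin.deriv_eq_zero ?_
    filter_upwards with s
    rw [etaTilde_of_le ht]
    exact (etaTilde_mem_Icc s).1
  · refine IsLocalMax.deriv_eq_zero ?_
    filter_upwards with s
    rw [etaTilde_of_ge ht]
    exact (etaTilde_mem_Icc s).2

/-- `η̃` as a `HasDerivAt` statement. [folklore] -/
theorem hasDerivAt_etaTilde (t : ℝ) : HasDerivAt etaTilde (deriv etaTilde t) t :=
  ((contDiff_etaTilde (n := 1)).differentiable one_ne_zero t).hasDerivAt

/-- The bump data of `η`: centre `1`, inner radius `1/4`, outer radius `3/10`. [cite: Cheskidov2023, §6 p. 18] -/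
def etaBump : ContDiffBump (1 : ℝ) := ⟨4⁻¹, 3 / 10, by norm_num, by norm_num⟩

/-- **The density cutoff `η`** (Cheskidov 2023, §6, p. 18, with `τ = 1`): a smooth bump, `= 1` on
`[1 - τ/4, 1 + τ/4] = [3/4, 5/4]` and supported in `[7/10, 13/10] ⊂ (1 - τ/3, 1 + τ/3)`. [cite: Cheskidov2023, §6 p. 18] -/
def eta : ℝ → ℝ := etaBump

/-- `η` is smooth. [cite: Cheskidov2023, §6 p. 18] -/
theorem contDiff_eta {n : ℕ∞} : ContDiff ℝ n eta := etaBump.contDiff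

/-- `η = 1` on `[3/4, 5/4]`. [cite: Cheskidov2023, §6 p. 18] -/
theorem eta_eq_one {t : ℝ} (ht : t ∈ Icc (3 / 4 : ℝ) (5 / 4)) : eta t = 1 := by
  refine etaBump.one_of_mem_closedBall ?_
  rw [Metric.mem_closedBall, Real.dist_eq, show etaBump.rIn = 4⁻¹ from rfl, abs_le]
  constructor <;> linarith [ht.1, ht.2]

/-- `tsupport η = [7/10, 13/10]`. [cite: Cheskidov2023, §6 p. 18] -/
theorem tsupport_eta : tsupport eta = Icc (7 / 10 : ℝ) (13 / 10) := by
  rw [eta, etaBump.tsupport_eq, show etaBump.rOut = 3 / 10 from rfl, Real.closedBall_eq_Icc]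
  norm_num

/-- `η t = 0` off the open interval `(7/10, 13/10)` (the support of the bump is the open ball). [cite: Cheskidov2023, §6 p. 18] -/
theorem eta_eq_zero {t : ℝ} (ht : t ∉ Ioo (7 / 10 : ℝ) (13 / 10)) : eta t = 0 := by
  have h : t ∉ Function.support eta := by
    rw [eta, etaBump.support_eq, show etaBump.rOut = 3 / 10 from rfl, Real.ball_eq_Ioo]
    norm_num at ht ⊢
    exact ht
  simpa [Function.mem_support] using h

/-- `0 ≤ η ≤ 1`. [cite: Cheskidov2023, §6 p. 18] -/
theorem eta_mem_Icc (t : ℝ) : eta t ∈ Icc (0 : ℝ) 1 := ⟨etaBump.nonneg, etaBump.le_one⟩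

/-- `η' t = 0` for `t ∈ [3/4, 5/4]` (where `η` attains its maximum `1`) and for
`t ∉ (7/10, 13/10)` (where it attains its minimum `0`); Fermat. [folklore] -/
theorem deriv_eta_eq_zero {t : ℝ} (ht : t ∈ Icc (3 / 4 : ℝ) (5 / 4) ∨ t ∉ Ioo (7 / 10 : ℝ) (13 / 10)) :
    deriv eta t = 0 := by
  rcases ht with ht | ht
  · refine IsLocalMax.deriv_eq_zero ?_
    filter_upwards with s
    rw [eta_eq_one ht]
    exact (eta_mem_Icc s).2
  · refine IsLocalMin.deriv_eq_zero ?_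
    filter_upwards with s
    rw [eta_eq_zero ht]
    exact (eta_mem_Icc s).1

/-- `η` as a `HasDerivAt` statement. [folklore] -/
theorem hasDerivAt_eta (t : ℝ) : HasDerivAt eta (deriv eta t) t :=
  ((contDiff_eta (n := 1)).differentiable one_ne_zero t).hasDerivAt

/-- `η'` is bounded: `|η' t| ≤ M` for some `M` (continuous with compact support). [folklore] -/
theorem exists_abs_deriv_eta_le : ∃ M : ℝ, 0 ≤ M ∧ ∀ t, |deriv eta t| ≤ M := by
  have hc : Continuous (deriv eta) := (contDiff_eta (n := 1)).continuous_deriv le_rfl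
  have hs : HasCompactSupport (deriv eta) := by
    refine HasCompactSupport.of_support_subset_isCompact (isCompact_Icc (a := (7 / 10 : ℝ)) (b := 13 / 10)) ?_
    intro t ht
    by_contra h
    exact ht (deriv_eta_eq_zero (Or.inr fun h' => h (Ioo_subset_Icc_self h')))
  obtain ⟨M, hM⟩ := hc.bounded_above_of_compact_support hs
  refine ⟨max M 0, le_max_right _ _, fun t => ?_⟩
  exact (Real.norm_eq_abs _ ▸ hM t).trans (le_max_left _ _)

/-- The smooth step down `stepDown t = smoothTransition (10 (9/10 - t))`: `1` for `t ≤ 4/5`, `0` for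
`t ≥ 9/10`. [folklore] -/
def stepDown (t : ℝ) : ℝ := Real.smoothTransition (10 * (9 / 10 - t))

/-- `stepDown` is smooth. [folklore] -/
theorem contDiff_stepDown {n : ℕ∞} : ContDiff ℝ n stepDown :=
  Real.smoothTransition.contDiff.comp (contDiff_const.mul (contDiff_const.sub contDiff_id))

/-- `stepDown t = 1` for `t ≤ 4/5`. [folklore] -/
theorem stepDown_of_le {t : ℝ} (ht : t ≤ 4 / 5) : stepDown t = 1 :=
  Real.smoothTransition.one_of_one_le (by linarith)

/-- `stepDown t = 0` for `t ≥ 9/10`. [folklore] -/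
theorem stepDown_of_ge {t : ℝ} (ht : 9 / 10 ≤ t) : stepDown t = 0 :=
  Real.smoothTransition.zero_of_nonpos (by linarith)

/-- **The truncated derivative `χ = η' · stepDown`**: the time profile of the limit scalar force
`h = η'(t) ρ̃(t) χ_{[1-τ/3, 1-τ/4]}(t)` of Cheskidov 2023, §6, p. 18, realised smoothly: `χ = η'`
for `t ≤ 4/5` (which contains `[1-τ/3, 1-τ/4] = [2/3, 3/4]`, the part of `supp η'` before the
blow-up time), `χ = 0` for `t ≥ 9/10`. [cite: Cheskidov2023, §6 p. 18] -/
def chi (t : ℝ) : ℝ := deriv eta t * stepDown t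

/-- `χ` is smooth. [folklore] -/
theorem contDiff_chi {n : ℕ∞} : ContDiff ℝ n chi :=
  ((contDiff_eta (n := n + 1)).deriv' ).mul contDiff_stepDown |>.of_le (by simp)

/-- `χ t = η' t` for `t ≤ 4/5`. [folklore] -/
theorem chi_of_le {t : ℝ} (ht : t ≤ 4 / 5) : chi t = deriv eta t := by
  rw [chi, stepDown_of_le ht, mul_one]

/-- `χ t = 0` for `t ≥ 9/10`. [folklore] -/
theorem chi_of_ge {t : ℝ} (ht : 9 / 10 ≤ t) : chi t = 0 := by
  rw [chi, stepDown_of_ge ht, mul_zero]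

/-- `χ t = 0` for `t ≤ 7/10` (there `η' = 0`). [folklore] -/
theorem chi_of_le' {t : ℝ} (ht : t ≤ 7 / 10) : chi t = 0 := by
  rw [chi, deriv_eta_eq_zero (Or.inr fun h => by linarith [h.1]), zero_mul]

/-- `tsupport χ ⊆ [7/10, 9/10]`. [folklore] -/
theorem tsupport_chi_subset : tsupport chi ⊆ Icc (7 / 10 : ℝ) (9 / 10) := by
  refine closure_minimal (fun t ht => ?_) isClosed_Icc
  rw [mem_support] at ht
  constructor
  · by_contra h
    exact ht (chi_of_le' (by linarith))
  · by_contra h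
    exact ht (chi_of_ge (by linarith))

end CheskidovPeriodic

end Literature.Analysis.FluidPDE

end
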